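import Summits.ResolutionOfSingularities.ResolutionOfSingularities.Theorems.FrobeniusLadderFRationalResolutionTwoStepModel
import Summits.ResolutionOfSingularities.ResolutionOfSingularities.Theorems.FrobeniusLadderFRationalResolutionChartHloc
import HarnessLib

/-!
# Crux `FrobeniusLadder.FRationalResolution` (stmt-ResolutionOfSingularities-15317), line `redirect`,
# stub `stub_diagonalizableQuotientResolution` — **`hloc` at a point whose point blow-up is resolved locally at its
# singular points** (brick P7-d of memo MEMO-15317-leafhand2-g8, scheme side: the induction step of the
# point-blow-up recursion in the currency of `…IsolatedGlue`; generalises `…ConeModels.hloc_of_cone_model` and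
# `…ChartHloc.hloc_of_affineOpen_model` from "`Bl_I` regular" to "`Bl_I` has finitely many singular points, each with
# `hloc`")

* `hloc_of_two_step_model` — germ form: `R` a domain of finite type over `k` with `Reg (Spec R) = Spec R ∖ V(I)`,
  `V(I) ⊆ {q}`, `Bl_I(Spec R)` with finitely many singular points each carrying `hloc`, and a `k`-isomorphism of
  germs `𝒪_{Spec R, q} ≅ 𝒪_{X,s}` ⇒ `hloc` at `s ∈ X`;
* `hloc_of_two_step_affineOpen` — the same for `ι : Spec R → X` an affine open (germ isomorphism = stalk map).

With CLAIM(d − 2) supplying `hloc` on `Bl_{𝔪_x}(Spec R)` this is the induction step CLAIM(d) of the memo's §3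
(P7-d); the base case is `…PointBlowupEtale.hloc_of_pointBlowup_flat_chart`. Honest label: scheme plumbing toward
ONE leaf stub (no stub, crux or summit closed). No definitions, no named facts, no sorry. [cite: Kollar2007, §2.2]
-/

noncomputable section

-- single-problem summit: the doubled namespace component is forced
set_option linter.dupNamespace false

open CategoryTheory AlgebraicGeometry TopologicalSpace
open Literature.AlgebraicGeometry.Resolution

namespace Summit.ResolutionOfSingularities.ResolutionOfSingularities.Theorems.FRationalResolution.TwoStepHloc

/-- **`hloc` from a two-step model (germ form).** [cite: Kollar2007, §2.2] -/
theorem hloc_of_two_step_model (k : Type) [Field k] (X : Scheme.{0}) [IsIntegral X]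
    (f : X ⟶ Spec (.of k)) [LocallyOfFiniteType f] (s : X)
    (R : Type) [CommRing R] [IsDomain R] [Algebra k R] [Algebra.FiniteType k R]
    (I : Ideal R) (hfg : I.FG) (hI : I ≠ ⊥)
    (hRegI : ∀ P : Spec (.of R), P ∈ Scheme.regularLocus (Spec (.of R)) ↔ ¬ I ≤ P.asIdeal)
    (q : Spec (.of R)) (hq : ∀ t : Spec (.of R), I ≤ t.asIdeal → t = q)
    (hopen : IsOpen (Scheme.regularLocus (affineBlowup I)))
    (hfin : (Scheme.regularLocus (affineBlowup I))ᶜ.Finite)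
    (hloc : ∀ y : affineBlowup I, y ∉ Scheme.regularLocus (affineBlowup I) →
      ∃ (V : (affineBlowup I).Opens), y ∈ V ∧
        (∀ t : affineBlowup I, t ∉ Scheme.regularLocus (affineBlowup I) → t ∈ V → t = y) ∧
        ∃ (Y' : Scheme.{0}) (ρ : Y' ⟶ V), IsProper ρ ∧ Scheme.IsRegular Y' ∧
          IsIso (ρ ∣_ (V.ι ⁻¹ᵁ ⟨Scheme.regularLocus (affineBlowup I), hopen⟩)) ∧
          Dense ((ρ ⁻¹ᵁ (V.ι ⁻¹ᵁ ⟨Scheme.regularLocus (affineBlowup I), hopen⟩) : Y'.Opens) : Set Y'))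
    (e : (Spec (.of R)).presheaf.stalk q ≅ X.presheaf.stalk s)
    (he : Spec.map e.hom ≫ (Spec (.of R)).fromSpecStalk q ≫
      Spec.map (CommRingCat.ofHom (algebraMap k R)) = X.fromSpecStalk s ≫ f) :
    ∃ (V : X.Opens), s ∈ V ∧ (∀ t : X, t ∉ Scheme.regularLocus X → t ∈ V → t = s) ∧
      ∃ (Y : Scheme.{0}) (ρ : Y ⟶ V), IsProper ρ ∧ Scheme.IsRegular Y ∧
        IsIso (ρ ∣_ (V.ι ⁻¹ᵁ ⟨Scheme.regularLocus X, isOpen_regularLocus_of_locallyOfFiniteType_field f⟩)) ∧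
        Dense ((ρ ⁻¹ᵁ (V.ι ⁻¹ᵁ ⟨Scheme.regularLocus X,
          isOpen_regularLocus_of_locallyOfFiniteType_field f⟩) : Y.Opens) : Set Y) := by
  haveI : LocallyOfFiniteType (Spec.map (CommRingCat.ofHom (algebraMap k R))) := by
    rw [HasRingHomProperty.Spec_iff (P := @LocallyOfFiniteType), CommRingCat.hom_ofHom]
    exact RingHom.finiteType_algebraMap.mpr inferInstance
  set g : Spec (.of R) ⟶ Spec (.of k) := Spec.map (CommRingCat.ofHom (algebraMap k R)) with hg
  have hopenR : IsOpen (Scheme.regularLocus (Spec (.of R))) :=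
    isOpen_regularLocus_of_locallyOfFiniteType_field g
  -- the only possibly singular point of the model is `q`
  have hq' : ∀ t : Spec (.of R), t ∉ Scheme.regularLocus (Spec (.of R)) → t = q := by
    intro t ht
    rw [hRegI, not_not] at ht
    exact hq t ht
  -- the model's two-step resolution, an isomorphism over `Reg = ⨆ D(a)`
  have hW := ConeModels.regularLocus_opens_eq_iSup_basicOpen I hopenR hRegI
  have hres : ∃ (Y : Scheme.{0}) (ρ : Y ⟶ Spec (.of R)), IsProper ρ ∧ Scheme.IsRegular Y ∧
      IsIso (ρ ∣_ ⟨Scheme.regularLocus (Spec (.of R)), isOpen_regularLocus_of_locallyOfFiniteType_field g⟩) ∧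
      Dense ((ρ ⁻¹ᵁ ⟨Scheme.regularLocus (Spec (.of R)),
        isOpen_regularLocus_of_locallyOfFiniteType_field g⟩ : Y.Opens) : Set Y) := by
    rw [hW]
    exact TwoStepModel.model_datum_of_local_resolutions k I hfg hI hRegI hopen hfin hloc
  exact LocalModelTransfer.hloc_of_stalk_iso_model k X f s (Spec (.of R)) g q hq' e he hres

/-- **`hloc` from a two-step model on an affine open of `X`.** [cite: Kollar2007, §2.2] -/
theorem hloc_of_two_step_affineOpen (k : Type) [Field k] (X : Scheme.{0}) [IsIntegral X]
    (f : X ⟶ Spec (.of k)) [LocallyOfFiniteType f]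
    (R : Type) [CommRing R] [IsDomain R] [Algebra k R] [Algebra.FiniteType k R]
    (ι : Spec (.of R) ⟶ X) [IsOpenImmersion ι] (hι : ι ≫ f = Spec.map (CommRingCat.ofHom (algebraMap k R)))
    (I : Ideal R) (hfg : I.FG) (hI : I ≠ ⊥)
    (hRegI : ∀ P : Spec (.of R), P ∈ Scheme.regularLocus (Spec (.of R)) ↔ ¬ I ≤ P.asIdeal)
    (q : Spec (.of R)) (hq : ∀ t : Spec (.of R), I ≤ t.asIdeal → t = q)
    (hopen : IsOpen (Scheme.regularLocus (affineBlowup I)))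
    (hfin : (Scheme.regularLocus (affineBlowup I))ᶜ.Finite)
    (hloc : ∀ y : affineBlowup I, y ∉ Scheme.regularLocus (affineBlowup I) →
      ∃ (V : (affineBlowup I).Opens), y ∈ V ∧
        (∀ t : affineBlowup I, t ∉ Scheme.regularLocus (affineBlowup I) → t ∈ V → t = y) ∧
        ∃ (Y' : Scheme.{0}) (ρ : Y' ⟶ V), IsProper ρ ∧ Scheme.IsRegular Y' ∧
          IsIso (ρ ∣_ (V.ι ⁻¹ᵁ ⟨Scheme.regularLocus (affineBlowup I), hopen⟩)) ∧
          Dense ((ρ ⁻¹ᵁ (V.ι ⁻¹ᵁ ⟨Scheme.regularLocus (affineBlowup I), hopen⟩) : Y'.Opens) : Set Y')) :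
    ∃ (V : X.Opens), ι q ∈ V ∧ (∀ t : X, t ∉ Scheme.regularLocus X → t ∈ V → t = ι q) ∧
      ∃ (Y : Scheme.{0}) (ρ : Y ⟶ V), IsProper ρ ∧ Scheme.IsRegular Y ∧
        IsIso (ρ ∣_ (V.ι ⁻¹ᵁ ⟨Scheme.regularLocus X, isOpen_regularLocus_of_locallyOfFiniteType_field f⟩)) ∧
        Dense ((ρ ⁻¹ᵁ (V.ι ⁻¹ᵁ ⟨Scheme.regularLocus X,
          isOpen_regularLocus_of_locallyOfFiniteType_field f⟩) : Y.Opens) : Set Y) := by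
  -- the germ isomorphism of the open immersion
  let e : (Spec (.of R)).presheaf.stalk q ≅ X.presheaf.stalk (ι q) := (asIso (ι.stalkMap q)).symm
  have he : Spec.map e.hom ≫ (Spec (.of R)).fromSpecStalk q ≫
      Spec.map (CommRingCat.ofHom (algebraMap k R)) = X.fromSpecStalk (ι q) ≫ f := by
    rw [← hι]
    have hnat := Scheme.SpecMap_stalkMap_fromSpecStalk ι (x := q)
    have h1 : (Spec (.of R)).fromSpecStalk q ≫ ι ≫ f =
        Spec.map (ι.stalkMap q) ≫ X.fromSpecStalk (ι q) ≫ f := by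
      rw [← Category.assoc, ← hnat, Category.assoc]
    rw [h1]
    change Spec.map (inv (ι.stalkMap q)) ≫ Spec.map (ι.stalkMap q) ≫ X.fromSpecStalk (ι q) ≫ f = _
    rw [← Category.assoc, ← Spec.map_comp, IsIso.hom_inv_id, Spec.map_id, Category.id_comp]
  exact hloc_of_two_step_model k X f (ι q) R I hfg hI hRegI q hq hopen hfin hloc e he

end Summit.ResolutionOfSingularities.ResolutionOfSingularities.Theorems.FRationalResolution.TwoStepHloc

end
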